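import Mathlib
import Literature.Analysis.FluidPDE.SuitableWeak
import Literature.Analysis.FluidPDE.SelfSimilar
import Literature.Analysis.FluidPDE.LocalTypeI

/-!
# Sketch — first lemmas of three crux ideas for `RellichScar.ApexLocalisation`
(stmt-NavierStokesRegularity-11719; planner-cruxidea …-11719-1-0, round 1).

Only statements (`def … : Prop`), over existing declarations; nothing is proved here.
* `ApexConclusion`       — the conclusion of the crux, verbatim shape.
* `RateClassSingular`    — the hypothesis class of the crux (rate-Type-I profile singular at 0).
* card `clock-mode-hyperbolicity`:  `ShellUniformityGivesApex`, `ApexZoom`.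
* card `dissipation-quantum-ground-state`: `AnnularDissipationQuantum`, `LowDissipationIsolation`.
* card `decaying-ancient-bridge`: `DecayingAncientGivesApex`.
-/

namespace Summit.NavierStokesRegularity.NavierStokesRegularity.Cruxes.ApexLocalisation

open MeasureTheory Set Function Metric Filter
open scoped ENNReal Topology

open Literature.Analysis.FluidPDE

local notation "E³" => EuclideanSpace ℝ (Fin 3)

/-- The slab `(-∞,0) × ℝ³` (time first), as in the route file. -/
noncomputable abbrev negSlab : TopologicalSpace.Opens (ℝ × E³) := slab E³ (Iio 0) isOpen_Iio

/-- Conclusion of `ApexLocalisation`, verbatim shape: an apex-class profile singular at the origin. -/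
def ApexConclusion : Prop :=
  ∃ (C' : ℝ) (u : ℝ → E³ → E³) (p : ℝ → E³ → ℝ) (G : ℝ → E³ → E³ →L[ℝ] E³),
    IsSuitableWeakSolutionOn negSlab 1 0 u p ∧ HasWeakSpatialGradientOn negSlab u G ∧
    typeIBound (Iio (0 : ℝ) ×ˢ univ) u p G < ⊤ ∧ HasTypeIDecay C' u ∧ IsBackwardSingularPoint u 0

/-- The hypothesis class of the crux with explicit constants: rate `C`, Albritton–Barker quantity
`𝐈 ≤ M`, singular at the space–time origin. -/
def RateClassSingular (C M : ℝ) (u : ℝ → E³ → E³) (p : ℝ → E³ → ℝ)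
    (G : ℝ → E³ → E³ →L[ℝ] E³) : Prop :=
  IsSuitableWeakSolutionOn negSlab 1 0 u p ∧ HasWeakSpatialGradientOn negSlab u G ∧
    typeIBound (Iio (0 : ℝ) ×ˢ univ) u p G ≤ ENNReal.ofReal M ∧ HasTypeITimeDecay C u ∧
    IsBackwardSingularPoint u 0

/-! ### Card A (`clock-mode-hyperbolicity`) -/

/-- **Apex criterion (shell uniformity ⇒ KNSS (1.6)).** Elementary: if `u` has the Type-I RATE and
ALL its Navier–Stokes zooms `u_λ = nsRescale λ u` are bounded by `θ⁻¹` on the unit shell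
`1 ≤ ‖x‖ ≤ 2` during the final times `-θ² < t < 0`, then `u` has the space–time Type-I bound
for some `C'` (explicitly `C' = max (C (1 + 3/(2θ))) ((3/(2θ)) (1 + 2θ/3))`). This is the
quantitative form of "apex ⇔ no long transients on the shell along the scaling orbit"; the
uniform-hyperbolicity bet of the card delivers exactly its hypothesis. Provable now (real analysis). -/
def ShellUniformityGivesApex : Prop :=
  ∀ (u : ℝ → E³ → E³) (C θ : ℝ), 0 < θ → HasTypeITimeDecay C u →
    (∀ lam : ℝ, 0 < lam → ∀ t : ℝ, -θ ^ 2 < t → t < 0 → ∀ x : E³, 1 ≤ ‖x‖ → ‖x‖ ≤ 2 →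
        ‖nsRescale lam u t x‖ ≤ θ⁻¹) →
    ∃ C' : ℝ, HasTypeIDecay C' u

/-- **Apex zoom (localisation of the conclusion).** If ANY suitable weak solution in a parabolic
ball `Q(z, r)` has finite `𝐈(Q(z,r))`, a backward-singular centre `z = (t₀, x₀)` and the LOCAL apex
bound `‖u(t,x)‖ ≤ C'/(‖x - x₀‖ + √(t₀ - t))` on `Q(z, r)`, then the crux's conclusion holds
(zoom at `z`: `SuitableCompactness` + `PersistenceOfSingularities`; the local bound is scale
invariant and becomes global). The card's perturbed solutions only ever deliver LOCAL apex points. -/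
def ApexZoom : Prop :=
  ∀ (u : ℝ → E³ → E³) (p : ℝ → E³ → ℝ) (G : ℝ → E³ → E³ →L[ℝ] E³) (z : ℝ × E³) (r C' : ℝ),
    0 < r → IsSuitableWeakSolutionInBall r z u p →
    HasWeakSpatialGradientOn (parabolicCylinderOpens r z) u G →
    typeIBound (parabolicCylinder r z) u p G < ⊤ →
    (∀ t : ℝ, z.1 - r ^ 2 < t → t < z.1 → ∀ x : E³, x ∈ ball z.2 r →
        ‖u t x‖ ≤ C' / (‖x - z.2‖ + Real.sqrt (z.1 - t))) →
    IsBackwardSingularPoint u z → ApexConclusion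

/-! ### Card C (`dissipation-quantum-ground-state`) -/

/-- **Annular dissipation quantum.** For every rate constant `C` and bound `M` there is
`e = e(C,M) > 0` such that every profile of the class singular at the origin dissipates at least `e`
in the unit backward ANNULAR band `(-1,-1/4) × B₁(0)` (weak gradient `G = ∇u`). Proof sketch:
compactness of the class (SuitableCompactness, PersistenceOfSingularities, lsc of the
dissipation) + a limit with zero band dissipation has `∇u = 0` on the band near 0, hence
(ess_unique_continuation for the vorticity + Liouville) `u(t) = b(t)` on ℝ³, `𝐈 < ∞` forces
`b = 0`, forward uniqueness of bounded mild solutions makes `u ≡ 0` up to `t = 0`: not singular.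
By scaling/translation the quantum holds at every singular point at every scale:
`∫_{(-ρ²,-ρ²/4)×B_ρ(b)} |∇u|² ≥ e ρ`. Uses the NS EQUATION (UC, mild uniqueness), not only LEI. -/
def AnnularDissipationQuantum (C M e : ℝ) : Prop :=
  ∀ (u : ℝ → E³ → E³) (p : ℝ → E³ → ℝ) (G : ℝ → E³ → E³ →L[ℝ] E³),
    RateClassSingular C M u p G →
      ENNReal.ofReal e ≤
        ∫⁻ q in (Ioo (-1 : ℝ) (-1 / 4)) ×ˢ ball (0 : E³) 1, ENNReal.ofReal (frobeniusNormSq (G q.1 q.2))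

/-- Existence form of the quantum. -/
def AnnularDissipationQuantumExists : Prop :=
  ∀ C M : ℝ, ∃ e : ℝ, 0 < e ∧ AnnularDissipationQuantum C M e

/-- **Low-dissipation regime ⇒ isolation (rigorous half of the card).** If the quantum `e` holds
for the class `(C, M)` and a profile `u` of that class, singular at the origin, has origin-anchored
scaled dissipation `sup_{r>0} E(Q((0,0), r)) = sup_r r⁻¹ ∫∫_{Q_r} |∇u|² < (9/4)·e` (note `≥ 2e` always holds, by
the mother's own dyadic quanta), then the origin is the ONLY final-time singular point: a companion at
distance `s` would cost the extra quanta `Σ_{ρ = s/4, s/8, …} e·ρ = e s/2` in regions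
`(-ρ², -ρ²/4) × B_ρ(b)` disjoint from the mother's dyadic quanta `Σ_{ρ ≤ 2s} e·ρ = 4es` inside
`Q((0,0), 2s)`, forcing `E(Q_{2s}) ≥ (9/4) e`. Since zooms and their limits inherit the
bound, isolation is hereditary along the scaling-orbit closure, whence apex by
`ShellUniformityGivesApex` + compactness. The BET of the card is that the regime is inhabited. -/
def LowDissipationIsolation : Prop :=
  ∀ (C M e : ℝ), 0 < e → AnnularDissipationQuantum C M e →
    ∀ (u : ℝ → E³ → E³) (p : ℝ → E³ → ℝ) (G : ℝ → E³ → E³ →L[ℝ] E³),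
      RateClassSingular C M u p G →
      (⨆ (r : ℝ) (_ : 0 < r), cknE r ((0 : ℝ), (0 : E³)) G) < ENNReal.ofReal (9 / 4 * e) →
      ∀ x : E³, x ≠ 0 → ¬ IsBackwardSingularPoint u ((0 : ℝ), x)

/-! ### Card D (`decaying-ancient-bridge`) -/

/-- **A decaying mild bounded ancient solution with `𝐈 < ∞` blows down to an apex profile.**
If `w` is a NON-trivial mild bounded ancient solution (KNSS) which, with some pressure, is a
suitable weak solution on the slab with finite Albritton–Barker quantity and which has the SHIFTED
space–time decay `‖w(t,x)‖ ≤ C'/(1 + ‖x‖ + √(-t))` (KNSS 2009 (1.6) regularised at the origin),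
then the crux's conclusion holds: the blow-downs `w_λ = nsRescale λ w`, `λ → ∞`, satisfy
`HasTypeIDecay C'` exactly, keep `𝐈`, and converge (SuitableCompactness) to a profile singular at
the origin (PersistenceOfSingularities, since `λ‖w‖_{L^∞(Q(0,λR))} → ∞`). This is the `⇐` half
of the card's transfer "ApexLocalisation ⇔ every Type-I scenario contains a decaying ancient
solution"; the `⇒` half is the Seregin–Šverák/A–B rescaling at near-maximum points of an apex
profile, which stay inside the parabola and therefore inherit (1.6). -/
def DecayingAncientGivesApex : Prop :=
  (∃ (w : ℝ → E³ → E³) (q : ℝ → E³ → ℝ) (H : ℝ → E³ → E³ →L[ℝ] E³) (C' : ℝ),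
      IsBoundedAncientMildSolution 1 w ∧ IsSuitableWeakSolutionOn negSlab 1 0 w q ∧
      HasWeakSpatialGradientOn negSlab w H ∧ typeIBound (Iio (0 : ℝ) ×ˢ univ) w q H < ⊤ ∧
      ¬ (uncurry w =ᵐ[volume.restrict (Iio (0 : ℝ) ×ˢ (univ : Set E³))] 0) ∧
      (∀ t : ℝ, t < 0 → ∀ x : E³, ‖w t x‖ ≤ C' / (1 + ‖x‖ + Real.sqrt (-t)))) →
    ApexConclusion

end Summit.NavierStokesRegularity.NavierStokesRegularity.Cruxes.ApexLocalisation
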